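import Summits.RiemannHypothesis.RiemannHypothesis.Theorems.PfPersistenceWindowSmooth
import HarnessLib

/-!
# The window energy of the Weil form is C¹ on (0, ½ log 2): the ground-state virial is a
# continuous function of the window (pub-rhpf, theory-1 gen 10; helper for crux
# `EvenSectorBarta.EvenOneSignedWindows`, item stmt-RiemannHypothesis-19953; RH-free)

**mechanism/rigidity campaign; no RH claims.**  Companion text:
`run/shared/lean/pub/pub-rhpf/pub-rhpf-theory-1/THEORY-EDGE-10.md`; prequel
`PfPersistenceWindowSmooth` (`ε` differentiable at every `a ∈ (0, ½ log 2)` with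
`ε'(a) = −V(u)/a` for every ground state `u`).

PROVED here (`ε = weilGroundEnergy`, `V_b(w) = weilSmallWindowVirial b w`):

* `exists_subseq_tendsto_weilSmallWindowVirial`, `tendsto_weilSmallWindowVirial_of_tendsto`:
  **the ground-state virial is a continuous function of the window** — if `bₙ → a` in `(0, L]`,
  `wₙ` are ground states of `bₙ` and `u` is a ground state of `a ≤ log 2`, then
  `V_{bₙ}(wₙ) → V_a(u)`.  Mechanism: near-minimisers `pₙ ≈ wₙ` of the moving windows, dilated into
  the limit window, are minimising there (window continuity of `ε` + the uniform dilation cost);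
  Connes–Consani–Moscovici compactness extracts an `L²`-convergent subsequence with limit a ground
  state `v` of `a`; undoing the dilations (strong continuity of the dilation group) the `pₙ`, hence
  the truncated `wₙ`, converge to `v`; the closed virial is continuous along `L²`-convergent window
  sequences (`tendsto_weilFormVirial_of_window`); and `V(v) = V(u)` by uniqueness up to phase
  (`weilSmallWindowVirial_eq_of_isWeilGroundState`) — which also makes the limit independent of
  the subsequence, so the full sequence converges;
* `continuousOn_deriv_weilGroundEnergy`, `contDiffOn_one_weilGroundEnergy`,
  `continuousOn_mul_deriv_weilGroundEnergy`: **`ε ∈ C¹(0, ½ log 2)`** and the edge law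
  `a ε'(a) = −V(u_a)` is an identity between continuous functions of the window there.

STRUCTURE versus ARITHMETIC: as in the prequel — everything is a theorem about the windowed form
below the first prime length, where the prime sum is invisible; the smoothness of `ε` there is
structure (Kato's analytic perturbation theory for a simple isolated eigenvalue, in variational
dress), not an arithmetic invariant.

References: T. Kato, *Perturbation Theory for Linear Operators* (1966), II §6.4, VII §4;
J. M. Danskin, SIAM J. Appl. Math. 14 (1966) 641–664, Thm 1; A. Connes, C. Consani,
H. Moscovici (2025), Thm 3.6.
-/

set_option linter.dupNamespace false

noncomputable section

open MeasureTheory Set Filter Metric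
open scoped Topology

namespace Summit.RiemannHypothesis.RiemannHypothesis.Theorems.PfPersistence

open Literature.NumberTheory.LFunctions

/-! ## §1 The ground-state virial is continuous in the window; `ε ∈ C¹(0, ½ log 2)` -/

/-- **Window continuity of the ground-state virial — subsequence form.**  Let `bₙ → a` be windows
in `(0, L]` with ground states `wₙ`, and let `u` be a ground state of the window `a ≤ log 2`
(`a ≤ L`).  Then along a subsequence `V_{bₙ}(wₙ) → V_a(u)`.  (Near-minimisers `pₙ ≈ wₙ` of the
windows `bₙ`, dilated into the window `a`, are minimising there; by the Connes–Consani–Moscovici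
compactness a subsequence converges in `L²` to a ground state `v` of `a`; undoing the dilations
(strong continuity of the dilation group) the `pₙ`, hence the truncations `w̃ₙ`, converge to `v`
too; the closed virial is continuous along such window sequences; and `V(v) = V(u)` by
uniqueness up to phase.) [cite: Kato1966, II §6.4 and VII §4; Danskin1966, Thm 1] -/
theorem exists_subseq_tendsto_weilSmallWindowVirial {a L : ℝ} (haL : a ≤ L)
    (ha2 : a ≤ Real.log 2) {b : ℕ → ℝ} (hbL : ∀ n, b n ≤ L) (hb : Tendsto b atTop (𝓝 a))
    {w : ℕ → ℝ → ℂ} (hw : ∀ n, IsWeilGroundState (b n) (w n)) {u : ℝ → ℂ}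
    (hu : IsWeilGroundState a u) :
    ∃ φ : ℕ → ℕ, StrictMono φ ∧ Tendsto (fun n ↦ weilSmallWindowVirial (b (φ n)) (w (φ n)))
      atTop (𝓝 (weilSmallWindowVirial a u)) := by
  have ha : 0 < a := hu.pos
  have ha' : a ≠ 0 := ha.ne'
  have hb0 : ∀ n, 0 < b n := fun n ↦ (hw n).pos
  have hL0 : 0 < L := ha.trans_le haL
  -- (1) near-minimisers `p n` of the windows `b n`, `L²`-close to `w n`
  have hδ : ∀ n : ℕ, (0 : ℝ) < 1 / ((n : ℝ) + 1) := fun n ↦ by positivity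
  have hex : ∀ n : ℕ, ∃ p : ℝ → ℂ, IsWeilTest p ∧ tsupport p ⊆ Icc (-(b n)) (b n) ∧
      ∫ x, ‖p x‖ ^ 2 = (1 : ℝ) ∧
      (weilQuadratic p).re < weilGroundEnergy (b n) + 1 / ((n : ℝ) + 1) ∧
      ∫ x, ‖p x - w n x‖ ^ 2 < 1 / ((n : ℝ) + 1) := by
    intro n
    obtain ⟨-, g, hg, hgQ, hgL⟩ := hw n
    have e1 : ∀ᶠ m in atTop,
        (weilQuadratic (g m)).re < weilGroundEnergy (b n) + 1 / ((n : ℝ) + 1) :=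
      hgQ.eventually (eventually_lt_nhds (by linarith [hδ n]))
    have e2 : ∀ᶠ m in atTop, ∫ x, ‖g m x - w n x‖ ^ 2 < 1 / ((n : ℝ) + 1) :=
      hgL.eventually (eventually_lt_nhds (hδ n))
    obtain ⟨m, hm1, hm2⟩ := (e1.and e2).exists
    exact ⟨g m, (hg m).1, (hg m).2.1, (hg m).2.2, hm1, hm2⟩
  choose p hp hps hpn hpQ hpw using hex
  have hpL : ∀ n, tsupport (p n) ⊆ Icc (-L) L := fun n ↦
    (hps n).trans (Icc_subset_Icc (neg_le_neg (hbL n)) (hbL n))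
  -- (2) dilation into the window `a`
  obtain ⟨η, hηdef⟩ : ∃ η : ℕ → ℝ, ∀ n, η n = b n / a - 1 := ⟨_, fun _ ↦ rfl⟩
  have hη1 : ∀ n, -1 < η n := fun n ↦ by rw [hηdef]; linarith [div_pos (hb0 n) ha]
  have hηpos : ∀ n, 0 < 1 + η n := fun n ↦ by linarith [hη1 n]
  have hηa : ∀ n, b n / (1 + η n) = a := fun n ↦ by
    have e : 1 + η n = b n / a := by rw [hηdef]; ring
    rw [e, div_div_eq_mul_div, mul_comm, mul_div_assoc, div_self (hb0 n).ne', mul_one]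
  obtain ⟨h, hhdef⟩ : ∃ h : ℕ → ℝ → ℂ, ∀ n, h n = weilDilate (η n) (p n) := ⟨_, fun _ ↦ rfl⟩
  have hh : ∀ n, IsWeilTest (h n) ∧ tsupport (h n) ⊆ Icc (-a) a ∧
      ∫ x, ‖h n x‖ ^ 2 = (1 : ℝ) := fun n ↦ by
    refine ⟨?_, ?_, ?_⟩
    · rw [hhdef]; exact (hp n).weilDilate (hη1 n)
    · have := tsupport_weilDilate_subset (p n) (hη1 n) (hps n)
      rwa [hηa, ← hhdef] at this
    · rw [hhdef, integral_norm_sq_weilDilate _ (hη1 n), hpn n]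
  -- (3) energies: the dilated near-minimisers are minimising for the window `a`
  have hεb : Tendsto (fun n ↦ weilGroundEnergy (b n)) atTop (𝓝 (weilGroundEnergy a)) :=
    (continuousAt_weilGroundEnergy ha).tendsto.comp hb
  have hN : Tendsto (fun n : ℕ ↦ 1 / ((n : ℝ) + 1)) atTop (𝓝 0) :=
    tendsto_one_div_add_atTop_nhds_zero_nat
  have hQp : Tendsto (fun n ↦ (weilQuadratic (p n)).re) atTop (𝓝 (weilGroundEnergy a)) := by
    refine tendsto_of_tendsto_of_tendsto_of_le_of_le hεb ?_
      (fun n ↦ weilGroundEnergy_le_re_weilQuadratic (hp n) (hps n) (hpn n))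
      (fun n ↦ (hpQ n).le)
    simpa using hεb.add hN
  have hE : ∀ᶠ n in atTop, (weilQuadratic (p n)).re ≤ weilGroundEnergy a + 1 :=
    hQp.eventually (Iic_mem_nhds (by linarith))
  have hη : Tendsto η atTop (𝓝 0) := by
    have h1 : Tendsto (fun n ↦ b n / a - 1) atTop (𝓝 (a / a - 1)) :=
      (hb.div_const a).sub_const 1
    rw [div_self ha', sub_self] at h1
    exact h1.congr fun n ↦ (hηdef n).symm
  have hQh : Tendsto (fun n ↦ (weilQuadratic (h n)).re) atTop (𝓝 (weilGroundEnergy a)) := by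
    have h1 := hQp.add (tendsto_re_weilQuadratic_weilDilate_sub hL0
      (fun n ↦ ⟨hp n, hpL n, hpn n⟩) hE hη)
    rw [add_zero] at h1
    refine h1.congr fun n ↦ ?_
    rw [hhdef]
    ring
  -- (4) compactness: a ground state `v` of the window `a`, truncated to the open window
  obtain ⟨v₀, hv₀2, φ, hφ, hconv⟩ :=
    ConnesConsaniMoscovici2025_thm_3_6_holds a ha h hh hQh.bddAbove_range
  have hv₀ : IsWeilGroundState a v₀ :=
    ⟨hv₀2, fun n ↦ h (φ n), fun n ↦ hh (φ n), hQh.comp hφ.tendsto_atTop, hconv⟩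
  obtain ⟨v, hvdef⟩ : ∃ v : ℝ → ℂ, v = weilTrunc a v₀ := ⟨_, rfl⟩
  have hv : IsWeilGroundState a v := hvdef ▸ isWeilGroundState_weilTrunc hv₀
  have hv2 : MemLp v 2 := hv.memLp
  have hva : ∀ x, a ≤ |x| → v x = 0 := fun x hx ↦ by rw [hvdef]; exact weilTrunc_eq_zero v₀ hx
  have hvR : ∀ x, x ∉ Icc (-L) L → v x = 0 := fun x hx ↦ by
    refine hva x (haL.trans ?_)
    rw [mem_Icc, not_and_or, not_le, not_le] at hx
    rcases hx with hx | hx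
    · exact (lt_abs.2 (Or.inr (by linarith))).le
    · exact (lt_abs.2 (Or.inl hx)).le
  have hconvh : Tendsto (fun n ↦ ∫ x, ‖h (φ n) x - v x‖ ^ 2) atTop (𝓝 0) := by
    refine hconv.congr' (Eventually.of_forall fun n ↦ integral_congr_ae ?_)
    filter_upwards [ae_eq_weilTrunc hv₀] with x hx
    rw [hvdef, ← hx]
  -- (5) undo the dilations: `p (φ n) → v` in `L²`
  obtain ⟨ζ, hζdef⟩ : ∃ ζ : ℕ → ℝ, ∀ n, ζ n = (1 + η n)⁻¹ - 1 := ⟨_, fun _ ↦ rfl⟩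
  have hζ1 : ∀ n, -1 < ζ n := fun n ↦ by rw [hζdef]; linarith [inv_pos.2 (hηpos n)]
  have hζ : Tendsto ζ atTop (𝓝 0) := by
    have h1 := ((hη.const_add 1).inv₀ (by norm_num)).sub_const 1
    rw [add_zero, inv_one, sub_self] at h1
    exact h1.congr fun n ↦ (hζdef n).symm
  have hpζ : ∀ n, p n = weilDilate (ζ n) (h n) := fun n ↦ by
    rw [hhdef, weilDilate_weilDilate (η n) (hζ1 n)]
    have e : (1 + ζ n) * (1 + η n) - 1 = 0 := by
      rw [hζdef, show (1 : ℝ) + ((1 + η n)⁻¹ - 1) = (1 + η n)⁻¹ by ring,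
        inv_mul_cancel₀ (hηpos n).ne', sub_self]
    rw [e, weilDilate_zero]
  have hconvp : Tendsto (fun n ↦ ∫ x, ‖p (φ n) x - v x‖ ^ 2) atTop (𝓝 0) := by
    have h1 := tendsto_integral_norm_sq_weilDilate_seq_sub hv2 (fun n ↦ (hh (φ n)).1.memLp_two)
      hconvh (fun n ↦ hζ1 (φ n)) (hζ.comp hφ.tendsto_atTop)
    refine h1.congr fun n ↦ ?_
    rw [← hpζ (φ n)]
  -- (6) the truncated ground states `w̃ (φ n)` converge to `v` in `L²`
  obtain ⟨q, hqdef⟩ : ∃ q : ℕ → ℝ → ℂ, ∀ n, q n = weilTrunc (b n) (w n) := ⟨_, fun _ ↦ rfl⟩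
  have hq : ∀ n, IsWeilGroundState (b n) (q n) := fun n ↦ by
    rw [hqdef]; exact isWeilGroundState_weilTrunc (hw n)
  have hq2 : ∀ n, MemLp (q n) 2 := fun n ↦ (hq n).memLp
  have hqR : ∀ n x, x ∉ Icc (-L) L → q n x = 0 := fun n x hx ↦ by
    rw [hqdef]
    refine weilTrunc_eq_zero (w n) ((hbL n).trans ?_)
    rw [mem_Icc, not_and_or, not_le, not_le] at hx
    rcases hx with hx | hx
    · exact (lt_abs.2 (Or.inr (by linarith))).le
    · exact (lt_abs.2 (Or.inl hx)).le
  have hqN : ∀ n, ∫ x, ‖q n x‖ ^ 2 ≤ 1 := fun n ↦ (hq n).integral_norm_sq.le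
  have hqp : ∀ n, ∫ x, ‖q n x - p n x‖ ^ 2 = ∫ x, ‖p n x - w n x‖ ^ 2 := fun n ↦ by
    refine integral_congr_ae ?_
    filter_upwards [ae_eq_weilTrunc (hw n)] with x hx
    rw [hqdef, ← hx, norm_sub_rev]
  have hconvq : Tendsto (fun n ↦ ∫ x, ‖q (φ n) x - v x‖ ^ 2) atTop (𝓝 0) := by
    have hup : ∀ n, ∫ x, ‖q (φ n) x - v x‖ ^ 2 ≤
        2 * (∫ x, ‖q (φ n) x - p (φ n) x‖ ^ 2) + 2 * ∫ x, ‖v x - p (φ n) x‖ ^ 2 := fun n ↦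
      GroundStateSimpleEven.integral_norm_sq_sub_le_two_mul (hq2 (φ n)) hv2 (hp (φ n)).memLp_two
    have h1 : Tendsto (fun n ↦ ∫ x, ‖q (φ n) x - p (φ n) x‖ ^ 2) atTop (𝓝 0) := by
      have h2 : Tendsto (fun n ↦ ∫ x, ‖p (φ n) x - w (φ n) x‖ ^ 2) atTop (𝓝 0) :=
        squeeze_zero (fun n ↦ integral_nonneg fun _ ↦ by positivity)
          (fun n ↦ (hpw (φ n)).le) (hN.comp hφ.tendsto_atTop)
      exact h2.congr fun n ↦ (hqp (φ n)).symm
    have h3 : Tendsto (fun n ↦ ∫ x, ‖v x - p (φ n) x‖ ^ 2) atTop (𝓝 0) := by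
      refine hconvp.congr fun n ↦ integral_congr_ae (Eventually.of_forall fun x ↦ ?_)
      simp only [norm_sub_rev]
    refine squeeze_zero (fun n ↦ integral_nonneg fun _ ↦ by positivity) hup ?_
    simpa using (h1.const_mul 2).add (h3.const_mul 2)
  -- (7) continuity of the closed virial along the window sequence, and uniqueness at the limit
  have hVq : Tendsto (fun n ↦ weilFormVirial (q (φ n))) atTop (𝓝 (weilFormVirial v)) :=
    tendsto_weilFormVirial_of_window (R := L) (N := 1) hv2 (fun n ↦ hq2 (φ n)) hvR
      (fun n x hx ↦ hqR (φ n) x hx) (fun n ↦ hqN (φ n)) hconvq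
  have hVv : weilFormVirial v = weilSmallWindowVirial a u := by
    have e1 : weilSmallWindowVirial a v = weilFormVirial v := by
      rw [weilSmallWindowVirial_eq_weilFormVirial hv2, weilTrunc_eq_self hva]
    rw [← e1]
    exact weilSmallWindowVirial_eq_of_isWeilGroundState ha2 hv hu
  refine ⟨φ, hφ, ?_⟩
  rw [← hVv]
  refine hVq.congr fun n ↦ ?_
  rw [hqdef, ← weilSmallWindowVirial_eq_weilFormVirial (a := b (φ n)) (hw (φ n)).memLp]

/-- **The ground-state virial is a continuous function of the window.**  If `bₙ → a` in `(0, L]`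
(`a ≤ L`, `a ≤ log 2`), `wₙ` are ground states of the windows `bₙ` and `u` is a ground state of
`a`, then `V_{bₙ}(wₙ) → V_a(u)` (every subsequence has a sub-subsequence along which this holds,
`exists_subseq_tendsto_weilSmallWindowVirial`, the limit being pinned by uniqueness up to phase).
[cite: Kato1966, II §6.4 and VII §4] -/
theorem tendsto_weilSmallWindowVirial_of_tendsto {a L : ℝ} (haL : a ≤ L) (ha2 : a ≤ Real.log 2)
    {b : ℕ → ℝ} (hbL : ∀ n, b n ≤ L) (hb : Tendsto b atTop (𝓝 a)) {w : ℕ → ℝ → ℂ}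
    (hw : ∀ n, IsWeilGroundState (b n) (w n)) {u : ℝ → ℂ} (hu : IsWeilGroundState a u) :
    Tendsto (fun n ↦ weilSmallWindowVirial (b n) (w n)) atTop
      (𝓝 (weilSmallWindowVirial a u)) := by
  refine tendsto_of_subseq_tendsto fun ψ hψ ↦ ?_
  obtain ⟨φ, -, hφ⟩ := exists_subseq_tendsto_weilSmallWindowVirial haL ha2 (b := b ∘ ψ)
    (fun n ↦ hbL (ψ n)) (hb.comp hψ) (w := w ∘ ψ) (fun n ↦ hw (ψ n)) hu
  exact ⟨φ, hφ⟩

/-- **`ε'` is continuous on `(0, ½ log 2)`**: `ε'(b) = −V_b(w_b)/b` at every small window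
(`deriv_weilGroundEnergy_eq`) and the ground-state virial is continuous in the window
(`tendsto_weilSmallWindowVirial_of_tendsto`). [cite: Kato1966, II §6.4] -/
theorem continuousOn_deriv_weilGroundEnergy :
    ContinuousOn (deriv weilGroundEnergy) (Ioo 0 (Real.log 2 / 2)) := by
  intro a ha
  obtain ⟨ha0, ha2⟩ := ha
  have hlog : 0 < Real.log 2 := Real.log_pos one_lt_two
  obtain ⟨L, hLdef⟩ : ∃ L : ℝ, L = (a + Real.log 2 / 2) / 2 := ⟨_, rfl⟩
  have haL : a < L := by rw [hLdef]; linarith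
  have hL2 : L < Real.log 2 / 2 := by rw [hLdef]; linarith
  have hIcc : Icc (a / 2) L ∈ 𝓝 a := Icc_mem_nhds (by linarith) haL
  obtain ⟨u, hu⟩ := ConnesConsaniMoscovici2025_thm_3_6.exists_isWeilGroundState
    ConnesConsaniMoscovici2025_thm_3_6_holds ha0
  have key : ContinuousWithinAt (deriv weilGroundEnergy) (Icc (a / 2) L) a := by
    refine tendsto_iff_seq_tendsto.2 fun x hx ↦ ?_
    rw [tendsto_nhdsWithin_iff] at hx
    obtain ⟨hxa, hxS⟩ := hx
    -- clamp the sequence into `[a/2, L]` (it is eventually there anyway)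
    obtain ⟨y, hydef⟩ : ∃ y : ℕ → ℝ, ∀ n, y n = max (a / 2) (min (x n) L) := ⟨_, fun _ ↦ rfl⟩
    have hy0 : ∀ n, 0 < y n := fun n ↦ by
      rw [hydef]; exact lt_of_lt_of_le (by linarith) (le_max_left _ _)
    have hyL : ∀ n, y n ≤ L := fun n ↦ by
      rw [hydef]; exact max_le (by linarith) (min_le_right _ _)
    have hya : Tendsto y atTop (𝓝 a) := by
      have h1 : Tendsto (fun n ↦ max (a / 2) (min (x n) L)) atTop
          (𝓝 (max (a / 2) (min a L))) := tendsto_const_nhds.max (hxa.min tendsto_const_nhds)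
      rw [min_eq_left haL.le, max_eq_right (by linarith : a / 2 ≤ a)] at h1
      exact h1.congr fun n ↦ (hydef n).symm
    have hxy : ∀ᶠ n in atTop, y n = x n := hxS.mono fun n hn ↦ by
      rw [hydef, min_eq_left hn.2, max_eq_right hn.1]
    choose wy hwy using fun n ↦ ConnesConsaniMoscovici2025_thm_3_6.exists_isWeilGroundState
      ConnesConsaniMoscovici2025_thm_3_6_holds (hy0 n)
    have hV := tendsto_weilSmallWindowVirial_of_tendsto haL.le
      ((haL.trans hL2).le.trans (by linarith)) hyL hya hwy hu
    have h1 : Tendsto (fun n ↦ -weilSmallWindowVirial (y n) (wy n) / y n) atTop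
        (𝓝 (-weilSmallWindowVirial a u / a)) := (hV.neg).div hya ha0.ne'
    have h2 : Tendsto (deriv weilGroundEnergy ∘ y) atTop (𝓝 (deriv weilGroundEnergy a)) := by
      rw [deriv_weilGroundEnergy_eq hu ha2]
      refine h1.congr fun n ↦ ?_
      rw [Function.comp_apply, deriv_weilGroundEnergy_eq (hwy n) ((hyL n).trans_lt hL2)]
    exact h2.congr' (hxy.mono fun n hn ↦ by rw [Function.comp_apply, Function.comp_apply, hn])
  exact (key.continuousAt hIcc).continuousWithinAt

/-- **`ε ∈ C¹(0, ½ log 2)`**: the window energy of the Weil form is continuously differentiable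
at every window below the first prime length. [cite: Kato1966, II §6.4] -/
theorem contDiffOn_one_weilGroundEnergy :
    ContDiffOn ℝ 1 weilGroundEnergy (Ioo 0 (Real.log 2 / 2)) := by
  have h := (contDiffOn_succ_iff_deriv_of_isOpen (𝕜 := ℝ) (n := 0) (f := weilGroundEnergy)
    isOpen_Ioo).2 ⟨differentiableOn_weilGroundEnergy, fun h ↦ absurd h (by simp),
      contDiffOn_zero.2 continuousOn_deriv_weilGroundEnergy⟩
  simpa using h

/-- **The edge law as a continuous identity**: `a ↦ a · ε'(a)` is continuous on `(0, ½ log 2)`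
and equals `−V(u_a)` there (`mul_deriv_weilGroundEnergy_eq_neg_virial`); i.e. the ground-state
virial `a ↦ V(u_a)` is a well-defined continuous function of the window. [cite: Kato1966, VII §4] -/
theorem continuousOn_mul_deriv_weilGroundEnergy :
    ContinuousOn (fun a ↦ a * deriv weilGroundEnergy a) (Ioo 0 (Real.log 2 / 2)) :=
  continuousOn_id.mul continuousOn_deriv_weilGroundEnergy

end Summit.RiemannHypothesis.RiemannHypothesis.Theorems.PfPersistence

end
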